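import Literature.Analysis.FluidPDE.SelfSimilarEulerProfileVorticity
import Literature.Analysis.FluidPDE.VorticityCalculus
import Literature.Analysis.FluidPDE.WholeSpaceIBP
import HarnessLib

/-!
# Self-similar Euler profiles: a compactly supported vorticity vanishes identically

Analysis/FluidPDE proofs file (theorems only; no definitions, no named facts) on the discharge path
of the named fact `Literature.Analysis.FluidPDE.chaeShvydkoy2013_vorticity_exclusion`
(`SelfSimilarEulerLpExclusion.lean`; Chae–Shvydkoy, ARMA 209 (2013) = arXiv:1201.6009, Thm 4.1:
a `C²` self-similar Euler profile whose strain tends to `0` at infinity and whose vorticity lies in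
`L^p` for some `0 < p < 3/(1+α)` is constant). The printed proof has two halves: an exterior
weighted `L^p` identity for the profile vorticity equation, which makes the vorticity vanish
outside a large ball (§4, proof of Thm 4.1, display (4.2) and the lines after it), and then "we
apply the result of [cha] to conclude `ω = 0` on `ℝ^N`" — Chae's Lagrangian argument
(D. Chae, Comm. Math. Phys. 273 (2007), Thm 1.1) that a self-similar vorticity vanishing near
infinity vanishes everywhere. This file PROVES that second half by a purely Eulerian argument, for
the tree's stationary self-similar Euler profiles in vorticity form
(`IsSelfSimilarEulerVorticityProfile γ c U`: `U ∈ C²`, `div U = 0`,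
`Ω + ((γ(y−c) + U)·∇)Ω = (Ω·∇)U`, `Ω = curl U`; CIV 2026 (3.4)) with `γ > 0`:

* `IsSelfSimilarEulerVorticityProfile.curl_eq_zero_of_hasCompactSupport` — **if `Ω = curl U` has
  compact support then `Ω ≡ 0`**;
* `IsSelfSimilarEulerProfile.curl_eq_zero_of_hasCompactSupport` — the same for velocity-form
  profiles (`IsSelfSimilarEulerProfile`, CIV (3.3)), via the tree's (3.3) ⇒ (3.4).

## Proof (the `p → 0` limit of the weighted `L^p` identity)

Write `V = γ(y−c) + U` (`selfSimilarTransport`; `div V = 3γ`, `divergence_selfSimilarTransport`)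
and `f = |Ω|²`. Along `V`, (3.4) gives `(V·∇)f = 2⟪Ω, DU Ω⟫ − 2f`. For `ε > 0` and an exponent
`0 < a < 1` the function `G_ε = (f + ε)^a − ε^a` is `C¹` with compact support (it vanishes exactly
where `Ω` does), so `∫ (V·∇)G_ε = −∫ G_ε div V = −3γ ∫ G_ε`
(`integral_mul_divergence_add_eq_zero_left`). Pointwise
`(V·∇)G_ε = 2a (f+ε)^{a−1} (⟪Ω, DU Ω⟫ − f)` and `|⟪Ω, DU Ω⟫| ≤ S f` with `S = sup_{supp Ω} ‖DU‖`,
whence, using `(f+ε)^{a−1} f ≤ f^a`,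
  `3γ ∫ G_ε = 2a ∫ (f+ε)^{a−1} (f − ⟪Ω, DU Ω⟫) ≤ 2a (1 + S) ∫ f^a`.
Letting `ε → 0` (dominated convergence, `0 ≤ G_ε ≤ f^a`): `3γ ∫ f^a ≤ 2a(1+S) ∫ f^a`. Choosing
`a` with `2a(1+S) < 3γ` forces `∫ f^a = 0`, i.e. `Ω ≡ 0`. (The exponent `p = 2a` plays the role of
Chae–Shvydkoy's `p < N/(1+α)`; the sign of the transport term is irrelevant in this half, only
`div V = 3γ > 0` is used.)

## References

* D. Chae, R. Shvydkoy, *On formation of a locally self-similar collapse in the incompressible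
  Euler equations*, ARMA 209 (2013) = arXiv:1201.6009, §4, Thm 4.1 and its proof.
  [ChaeShvydkoy2013]
* D. Chae, *Nonexistence of self-similar singularities for the 3D incompressible Euler
  equations*, Comm. Math. Phys. 273 (2007) 203–215, Thm 1.1 (the cited "[cha]").
* P. Constantin, M. Ignatova, V. Vicol, arXiv:2602.17570 (2026), §3.1.1 (3.3)–(3.4), §3.4.1
  ("`∇·(γy + U) = 3γ`"). [ConstantinIgnatovaVicol2026Putative]

## Mathlib / tree search

Reused: `IsSelfSimilarEulerVorticityProfile` (+ `.vorticity_eq`, `.differentiable_curl`),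
`IsSelfSimilarEulerProfile.isSelfSimilarEulerVorticityProfile`, `selfSimilarTransport`,
`divergence_selfSimilarTransport` (`SelfSimilarEulerProfile(Vorticity)`), `contDiff_curl`
(`VorticityCalculus`), `integral_mul_divergence_add_eq_zero_left` (`WholeSpaceIBP`); Mathlib
`HasFDerivAt.norm_sq`, `HasFDerivAt.rpow_const`, `ContDiff.rpow_const_of_ne`,
`NNReal.rpow_add_le_add_rpow`, `tendsto_integral_of_dominated_convergence`,
`integral_eq_zero_iff_of_nonneg`, `Continuous.ae_eq_iff_eq`. `lean search 'HasCompactSupport (curl'`: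
only `hasCompactSupport_curl` (curl of a compactly supported field); no Liouville-type statement
for compactly supported vorticity of a profile was in the tree.
-/

noncomputable section

open MeasureTheory Set Filter Function Topology InnerProductSpace Metric
open scoped RealInnerProductSpace NNReal

namespace Literature.Analysis.FluidPDE

/-! ### Real-variable lemmas on `t ↦ t^a`, `0 < a ≤ 1` -/

/-- Subadditivity of `t ↦ t^a` for `0 ≤ a ≤ 1` on `[0, ∞)`: `(x + y)^a ≤ x^a + y^a`
(Mathlib's `NNReal.rpow_add_le_add_rpow`, transported to `ℝ`). [folklore] -/
private theorem rpow_add_le_add_rpow_real {x y a : ℝ} (hx : 0 ≤ x) (hy : 0 ≤ y) (ha : 0 ≤ a)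
    (ha1 : a ≤ 1) : (x + y) ^ a ≤ x ^ a + y ^ a := by
  lift x to ℝ≥0 using hx
  lift y to ℝ≥0 using hy
  have h := NNReal.rpow_add_le_add_rpow x y ha ha1
  exact_mod_cast h

/-- For `0 ≤ f`, `0 < ε` and `a ≤ 1`: `(f + ε)^{a-1} f ≤ f^a` (the factor `(f+ε)^{a−1}` is at
most `f^{a−1}` where `f > 0`). [cite: ChaeShvydkoy2013, §4, proof of Thm 4.1 (the multiplier |ω|^(p-2), regularised)] -/
theorem rpow_sub_one_mul_le_rpow {f ε a : ℝ} (hf : 0 ≤ f) (hε : 0 < ε) (ha1 : a ≤ 1) :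
    (f + ε) ^ (a - 1) * f ≤ f ^ a := by
  rcases hf.eq_or_lt with h | h
  · rw [← h, mul_zero]
    exact Real.rpow_nonneg le_rfl _
  · have h1 : (f + ε) ^ (a - 1) ≤ f ^ (a - 1) :=
      Real.rpow_le_rpow_of_nonpos h (by linarith) (by linarith)
    calc (f + ε) ^ (a - 1) * f ≤ f ^ (a - 1) * f := mul_le_mul_of_nonneg_right h1 hf
      _ = f ^ a := by
        rw [Real.rpow_sub_one h.ne']
        field_simp

/-- For `0 ≤ f`, `0 < ε`, `0 ≤ a ≤ 1`: `0 ≤ (f + ε)^a − ε^a ≤ f^a`. [cite: ChaeShvydkoy2013, §4, proof of Thm 4.1 (the multiplier |ω|^(p-2), regularised)] -/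
theorem rpow_add_sub_rpow_mem_Icc {f ε a : ℝ} (hf : 0 ≤ f) (hε : 0 < ε) (ha : 0 ≤ a)
    (ha1 : a ≤ 1) : (f + ε) ^ a - ε ^ a ∈ Icc 0 (f ^ a) := by
  constructor
  · exact sub_nonneg.2 (Real.rpow_le_rpow hε.le (by linarith) ha)
  · have := rpow_add_le_add_rpow_real hf hε.le ha ha1
    linarith

/-- `ε ↦ (f + ε)^a − ε^a` tends to `f^a` as `ε = 1/(n+1) → 0` (`0 < a`; any real `f`, with Mathlib's
`rpow` on negatives). [cite: ChaeShvydkoy2013, §4, proof of Thm 4.1 (the multiplier |ω|^(p-2), regularised)] -/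
theorem tendsto_rpow_add_sub_rpow (f : ℝ) {a : ℝ} (ha : 0 < a) :
    Tendsto (fun n : ℕ => (f + 1 / ((n : ℝ) + 1)) ^ a - (1 / ((n : ℝ) + 1)) ^ a) atTop
      (𝓝 (f ^ a)) := by
  have hε : Tendsto (fun n : ℕ => (1 : ℝ) / ((n : ℝ) + 1)) atTop (𝓝 0) :=
    tendsto_one_div_add_atTop_nhds_zero_nat
  have h1 : Tendsto (fun n : ℕ => (f + 1 / ((n : ℝ) + 1)) ^ a) atTop (𝓝 (f ^ a)) := by
    have h := ((tendsto_const_nhds (x := f)).add hε).rpow_const (p := a) (Or.inr ha.le)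
    rw [add_zero] at h
    exact h
  have h2 : Tendsto (fun n : ℕ => ((1 : ℝ) / ((n : ℝ) + 1)) ^ a) atTop (𝓝 0) := by
    have h := hε.rpow_const (p := a) (Or.inr ha.le)
    rw [Real.zero_rpow ha.ne'] at h
    exact h
  have h3 := h1.sub h2
  rw [sub_zero] at h3
  exact h3

/-! ### The regularised power of `|Ω|²` and its derivative along the transport field -/

section Regularised

variable {Ω : (EuclideanSpace ℝ (Fin 3)) → (EuclideanSpace ℝ (Fin 3))}

/-- For a differentiable field `Ω`, `ε > 0` and any real `a`, the regularised power
`G(y) = (|Ω(y)|² + ε)^a − ε^a` is differentiable with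
`DG(y) w = 2a (|Ω(y)|² + ε)^{a−1} ⟪Ω(y), DΩ(y) w⟫`. [cite: ChaeShvydkoy2013, §4, proof of Thm 4.1 (the multiplier |ω|^(p-2), regularised)] -/
theorem hasFDerivAt_rpow_norm_sq_add (hΩ : Differentiable ℝ Ω) {ε : ℝ} (hε : 0 < ε) (a : ℝ)
    (y : (EuclideanSpace ℝ (Fin 3))) :
    HasFDerivAt (fun z => (‖Ω z‖ ^ 2 + ε) ^ a - ε ^ a)
      ((2 * a * (‖Ω y‖ ^ 2 + ε) ^ (a - 1)) • (innerSL ℝ (Ω y)).comp (fderiv ℝ Ω y)) y := by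
  have h1 : HasFDerivAt (fun z => ‖Ω z‖ ^ 2 + ε)
      ((innerSL ℝ (Ω y)).comp (fderiv ℝ Ω y) + (innerSL ℝ (Ω y)).comp (fderiv ℝ Ω y)) y := by
    have h := ((hΩ y).hasFDerivAt.norm_sq).add_const ε
    rw [two_smul] at h
    exact h
  have hpos : ‖Ω y‖ ^ 2 + ε ≠ 0 := by positivity
  refine ((h1.rpow_const (Or.inl hpos)).sub_const (ε ^ a)).congr_fderiv ?_
  ext w
  simp only [_root_.smul_apply, _root_.add_apply,
    ContinuousLinearMap.coe_comp, Function.comp_apply, innerSL_apply_apply, smul_eq_mul]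
  ring

/-- The derivative of the regularised power along a vector `w`, as a real number:
`DG(y) w = 2a (|Ω(y)|² + ε)^{a−1} ⟪Ω(y), DΩ(y) w⟫`. [cite: ChaeShvydkoy2013, §4, proof of Thm 4.1 (the multiplier |ω|^(p-2), regularised)] -/
theorem fderiv_rpow_norm_sq_add_apply (hΩ : Differentiable ℝ Ω) {ε : ℝ} (hε : 0 < ε) (a : ℝ)
    (y w : (EuclideanSpace ℝ (Fin 3))) :
    fderiv ℝ (fun z => (‖Ω z‖ ^ 2 + ε) ^ a - ε ^ a) y w =
      2 * a * (‖Ω y‖ ^ 2 + ε) ^ (a - 1) * ⟪Ω y, fderiv ℝ Ω y w⟫ := by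
  rw [(hasFDerivAt_rpow_norm_sq_add hΩ hε a y).fderiv]
  simp only [_root_.smul_apply, ContinuousLinearMap.coe_comp, Function.comp_apply,
    innerSL_apply_apply, smul_eq_mul]

/-- The regularised power is `C¹` when `Ω` is. [cite: ChaeShvydkoy2013, §4, proof of Thm 4.1 (the multiplier |ω|^(p-2), regularised)] -/
theorem contDiff_rpow_norm_sq_add (hΩ : ContDiff ℝ 1 Ω) {ε : ℝ} (hε : 0 < ε) (a : ℝ) :
    ContDiff ℝ 1 (fun z => (‖Ω z‖ ^ 2 + ε) ^ a - ε ^ a) := by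
  have h1 : ContDiff ℝ 1 (fun z => ‖Ω z‖ ^ 2 + ε) := (hΩ.norm_sq ℝ).add contDiff_const
  exact (h1.rpow_const_of_ne fun z => by positivity).sub contDiff_const

/-- The regularised power vanishes exactly where `Ω` does; in particular it inherits compact
support from `Ω`. [cite: ChaeShvydkoy2013, §4, proof of Thm 4.1 (the multiplier |ω|^(p-2), regularised)] -/
theorem hasCompactSupport_rpow_norm_sq_add (hc : HasCompactSupport Ω) (ε a : ℝ) :
    HasCompactSupport (fun z => (‖Ω z‖ ^ 2 + ε) ^ a - ε ^ a) := by
  refine hc.mono fun z hz => ?_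
  rw [mem_support] at hz ⊢
  contrapose! hz
  simp [hz]

end Regularised

/-! ### Compactly supported vorticity of a self-similar profile vanishes -/

namespace IsSelfSimilarEulerVorticityProfile

variable {γ : ℝ} {c : (EuclideanSpace ℝ (Fin 3))} {U : (EuclideanSpace ℝ (Fin 3)) → (EuclideanSpace ℝ (Fin 3))}

/-- The vorticity equation (3.4) solved for the transport derivative:
`DΩ(y)[V(y)] = DU(y)[Ω(y)] − Ω(y)`, `V = γ(y−c) + U`, `Ω = curl U`. [cite: ConstantinIgnatovaVicol2026Putative, §3.1.1 eq. (3.4)] -/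
theorem fderiv_curl_transport (h : IsSelfSimilarEulerVorticityProfile γ c U) (y : (EuclideanSpace ℝ (Fin 3))) :
    fderiv ℝ (curl U) y (selfSimilarTransport γ c U y) = fderiv ℝ U y (curl U y) - curl U y := by
  have e := h.vorticity_eq_transport y
  rw [eq_sub_iff_add_eq, add_comm]
  exact e

/-- **The weighted `L^p`-type inequality at level `ε`.** For a vorticity-form profile with
`γ > 0`, compactly supported `Ω = curl U`, a bound `‖DU‖ ≤ S` on the support of `Ω`, and
`0 < a ≤ 1`, `ε > 0`:
  `3γ ∫ ((|Ω|²+ε)^a − ε^a) ≤ 2a(1+S) ∫ |Ω|^{2a}`.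
(Integrate `div (G_ε V) = G_ε div V + (V·∇)G_ε` over `(EuclideanSpace ℝ (Fin 3))`, `div V = 3γ`, and bound
`(V·∇)G_ε = 2a(f+ε)^{a−1}(⟪Ω, DU Ω⟫ − f) ≥ −2a(1+S) f^a`.) [cite: ChaeShvydkoy2013, §4 proof of Thm 4.1] -/
theorem integral_rpow_norm_sq_curl_add_le (h : IsSelfSimilarEulerVorticityProfile γ c U)
    (hc : HasCompactSupport (curl U)) {S : ℝ} (hS0 : 0 ≤ S)
    (hS : ∀ y ∈ tsupport (curl U), ‖fderiv ℝ U y‖ ≤ S) {a : ℝ} (ha : 0 < a) (ha1 : a ≤ 1)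
    {ε : ℝ} (hε : 0 < ε) :
    3 * γ * ∫ y, ((‖curl U y‖ ^ 2 + ε) ^ a - ε ^ a) ≤
      2 * a * (1 + S) * ∫ y, (‖curl U y‖ ^ 2) ^ a := by
  set Ω : (EuclideanSpace ℝ (Fin 3)) → (EuclideanSpace ℝ (Fin 3)) := curl U with hΩdef
  set V : (EuclideanSpace ℝ (Fin 3)) → (EuclideanSpace ℝ (Fin 3)) := selfSimilarTransport γ c U with hVdef
  set G : (EuclideanSpace ℝ (Fin 3)) → ℝ := fun z => (‖Ω z‖ ^ 2 + ε) ^ a - ε ^ a with hGdef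
  have hU2 : ContDiff ℝ 2 U := h.contDiff_velocity
  have hΩ1 : ContDiff ℝ 1 Ω := contDiff_curl (n := 1) (by exact_mod_cast hU2)
  have hΩd : Differentiable ℝ Ω := h.differentiable_curl
  have hUd : Differentiable ℝ U := hU2.differentiable (by norm_num)
  have hV1 : ContDiff ℝ 1 V := by
    have : ContDiff ℝ 1 fun y : (EuclideanSpace ℝ (Fin 3)) => γ • (y - c) + U y :=
      ((contDiff_id.sub contDiff_const).const_smul γ).add (hU2.of_le (by norm_num))
    exact this
  have hG1 : ContDiff ℝ 1 G := contDiff_rpow_norm_sq_add hΩ1 hε a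
  have hGc : HasCompactSupport G := hasCompactSupport_rpow_norm_sq_add hc ε a
  -- integration by parts: `∫ G div V + ∫ ⟪V, ∇G⟫ = 0`, `div V = 3γ`
  have hibp := integral_mul_divergence_add_eq_zero_left hG1 hV1 hGc
  have hdiv : ∀ y, VectorCalculus.divergence V y = 3 * γ := fun y =>
    divergence_selfSimilarTransport hUd h.divFree y
  simp_rw [hdiv] at hibp
  rw [integral_mul_const] at hibp
  -- the pointwise stretching bound `|⟪Ω, DU Ω⟫| ≤ S |Ω|²` (everywhere: off the support both vanish)
  have hstretch : ∀ y, |⟪Ω y, fderiv ℝ U y (Ω y)⟫| ≤ S * ‖Ω y‖ ^ 2 := by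
    intro y
    by_cases hy : y ∈ tsupport Ω
    · calc |⟪Ω y, fderiv ℝ U y (Ω y)⟫| ≤ ‖Ω y‖ * ‖fderiv ℝ U y (Ω y)‖ := abs_real_inner_le_norm _ _
        _ ≤ ‖Ω y‖ * (S * ‖Ω y‖) := by
          refine mul_le_mul_of_nonneg_left ?_ (norm_nonneg _)
          exact (ContinuousLinearMap.le_opNorm _ _).trans
            (mul_le_mul_of_nonneg_right (hS y hy) (norm_nonneg _))
        _ = S * ‖Ω y‖ ^ 2 := by ring
    · have h0 : Ω y = 0 := image_eq_zero_of_notMem_tsupport hy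
      simp [h0]
  -- the pointwise identity and bound for `⟪V, ∇G⟫`
  have hptw : ∀ y, -⟪V y, gradient G y⟫ ≤ 2 * a * (1 + S) * (‖Ω y‖ ^ 2) ^ a := by
    intro y
    have hid : ⟪V y, gradient G y⟫ =
        2 * a * (‖Ω y‖ ^ 2 + ε) ^ (a - 1) * (⟪Ω y, fderiv ℝ U y (Ω y)⟫ - ‖Ω y‖ ^ 2) := by
      rw [real_inner_comm, inner_gradient_left (𝕜 := ℝ), hGdef, fderiv_rpow_norm_sq_add_apply hΩd hε a,
        hΩdef, hVdef, h.fderiv_curl_transport y, inner_sub_right, real_inner_self_eq_norm_sq]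
    rw [hid]
    have hfa : 0 ≤ (‖Ω y‖ ^ 2 + ε) ^ (a - 1) := Real.rpow_nonneg (by positivity) _
    have hb : -(⟪Ω y, fderiv ℝ U y (Ω y)⟫ - ‖Ω y‖ ^ 2) ≤ (1 + S) * ‖Ω y‖ ^ 2 := by
      have := (abs_le.1 (hstretch y)).1
      nlinarith
    have hkey : (‖Ω y‖ ^ 2 + ε) ^ (a - 1) * ‖Ω y‖ ^ 2 ≤ (‖Ω y‖ ^ 2) ^ a :=
      rpow_sub_one_mul_le_rpow (sq_nonneg _) hε ha1
    calc -(2 * a * (‖Ω y‖ ^ 2 + ε) ^ (a - 1) * (⟪Ω y, fderiv ℝ U y (Ω y)⟫ - ‖Ω y‖ ^ 2))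
        = 2 * a * ((‖Ω y‖ ^ 2 + ε) ^ (a - 1) * -(⟪Ω y, fderiv ℝ U y (Ω y)⟫ - ‖Ω y‖ ^ 2)) := by
          ring
      _ ≤ 2 * a * ((‖Ω y‖ ^ 2 + ε) ^ (a - 1) * ((1 + S) * ‖Ω y‖ ^ 2)) := by
          gcongr
      _ = 2 * a * (1 + S) * ((‖Ω y‖ ^ 2 + ε) ^ (a - 1) * ‖Ω y‖ ^ 2) := by ring
      _ ≤ 2 * a * (1 + S) * (‖Ω y‖ ^ 2) ^ a := by
          gcongr
  -- integrability of the two sides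
  have hΩc : Continuous Ω := hΩ1.continuous
  have hfa_cont : Continuous fun y => (‖Ω y‖ ^ 2) ^ a :=
    (hΩc.norm.pow 2).rpow_const fun _ => Or.inr ha.le
  have hfa_supp : HasCompactSupport fun y => (‖Ω y‖ ^ 2) ^ a := by
    refine hc.mono fun z hz => ?_
    rw [mem_support] at hz ⊢
    contrapose! hz
    simp [hz, Real.zero_rpow ha.ne']
  have hfa_int : Integrable (fun y => (‖Ω y‖ ^ 2) ^ a) :=
    hfa_cont.integrable_of_hasCompactSupport hfa_supp
  have hinner_int : Integrable (fun y => ⟪V y, gradient G y⟫) := by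
    refine (hV1.continuous.inner (continuous_gradient_of_contDiff hG1))
      |>.integrable_of_hasCompactSupport (hGc.mono' fun x hx => ?_)
    contrapose! hx
    simp only [mem_support, not_not]
    rw [gradient_eq_zero_of_notMem_tsupport hx, inner_zero_right]
  -- assemble
  have hle : -∫ y, ⟪V y, gradient G y⟫ ≤ ∫ y, 2 * a * (1 + S) * (‖Ω y‖ ^ 2) ^ a := by
    rw [← integral_neg]
    exact integral_mono hinner_int.neg (hfa_int.const_mul _) hptw
  rw [integral_const_mul] at hle
  have e : 3 * γ * ∫ y, G y = -∫ y, ⟪V y, gradient G y⟫ := by linarith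
  rw [e]
  exact hle

/-- **A compactly supported vorticity of a self-similar Euler profile vanishes identically**
(the Eulerian replacement for Chae–Shvydkoy's appeal to Chae 2007 at the end of the proof of
Thm 4.1: "and hence `ω = 0` on `{|y| > R}`. Now we apply the result of [cha] to conclude `ω = 0`
on `ℝ^N`"). For a vorticity-form profile (CIV (3.4)) with exponent `γ > 0` and any centre: if
`curl U` has compact support, then `curl U = 0`. Proof: the `ε → 0` limit of
`integral_rpow_norm_sq_curl_add_le` gives `3γ ∫ |Ω|^{2a} ≤ 2a(1+S) ∫ |Ω|^{2a}` for every
`0 < a ≤ 1`; with `2a(1+S) < 3γ` this forces `∫ |Ω|^{2a} = 0`. [cite: ChaeShvydkoy2013, §4 Thm 4.1 (proof, last paragraph)] -/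
theorem curl_eq_zero_of_hasCompactSupport (h : IsSelfSimilarEulerVorticityProfile γ c U)
    (hγ : 0 < γ) (hc : HasCompactSupport (curl U)) : curl U = 0 := by
  set Ω : (EuclideanSpace ℝ (Fin 3)) → (EuclideanSpace ℝ (Fin 3)) := curl U with hΩdef
  have hU2 : ContDiff ℝ 2 U := h.contDiff_velocity
  have hΩ1 : ContDiff ℝ 1 Ω := contDiff_curl (n := 1) (by exact_mod_cast hU2)
  have hΩc : Continuous Ω := hΩ1.continuous
  -- a bound `S` for `‖DU‖` on the (compact) support of `Ω`
  have hDUc : Continuous (fderiv ℝ U) := hU2.continuous_fderiv (by norm_num)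
  obtain ⟨S₀, hS₀⟩ : ∃ S₀, ∀ y ∈ tsupport Ω, ‖fderiv ℝ U y‖ ≤ S₀ := by
    obtain ⟨S₀, hS₀⟩ := hc.isCompact.bddAbove_image hDUc.norm.continuousOn
    exact ⟨S₀, fun y hy => hS₀ (Set.mem_image_of_mem _ hy)⟩
  set S : ℝ := max S₀ 0 with hSdef
  have hS0 : 0 ≤ S := le_max_right _ _
  have hS : ∀ y ∈ tsupport Ω, ‖fderiv ℝ U y‖ ≤ S := fun y hy => (hS₀ y hy).trans (le_max_left _ _)
  -- the exponent: `0 < a ≤ 1/2` with `2a(1+S) ≤ 2γ < 3γ`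
  set a : ℝ := min (1 / 2) (γ / (1 + S)) with hadef
  have ha : 0 < a := lt_min (by norm_num) (div_pos hγ (by linarith))
  have ha1 : a ≤ 1 := (min_le_left _ _).trans (by norm_num)
  have haS : 2 * a * (1 + S) ≤ 2 * γ := by
    have h1 : a * (1 + S) ≤ γ := by
      have := min_le_right (1 / 2 : ℝ) (γ / (1 + S))
      rw [← hadef] at this
      calc a * (1 + S) ≤ γ / (1 + S) * (1 + S) := mul_le_mul_of_nonneg_right this (by linarith)
        _ = γ := by field_simp
    linarith
  -- the target functional `I = ∫ |Ω|^{2a}`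
  set fa : (EuclideanSpace ℝ (Fin 3)) → ℝ := fun y => (‖Ω y‖ ^ 2) ^ a with hfadef
  have hfa_cont : Continuous fa := (hΩc.norm.pow 2).rpow_const fun _ => Or.inr ha.le
  have hfa_supp : HasCompactSupport fa := by
    refine hc.mono fun z hz => ?_
    rw [mem_support] at hz ⊢
    contrapose! hz
    simp [hfadef, hz, Real.zero_rpow ha.ne']
  have hfa_int : Integrable fa := hfa_cont.integrable_of_hasCompactSupport hfa_supp
  have hfa_nn : ∀ y, 0 ≤ fa y := fun y => Real.rpow_nonneg (sq_nonneg _) _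
  -- the `ε`-family and its limit
  set Gn : ℕ → (EuclideanSpace ℝ (Fin 3)) → ℝ := fun n y =>
    (‖Ω y‖ ^ 2 + 1 / ((n : ℝ) + 1)) ^ a - (1 / ((n : ℝ) + 1)) ^ a with hGndef
  have hεn : ∀ n : ℕ, (0 : ℝ) < 1 / ((n : ℝ) + 1) := fun n => by positivity
  have hGn_le : ∀ n, 3 * γ * ∫ y, Gn n y ≤ 2 * a * (1 + S) * ∫ y, fa y := fun n =>
    h.integral_rpow_norm_sq_curl_add_le hc hS0 hS ha ha1 (hεn n)
  have hlim : Tendsto (fun n => ∫ y, Gn n y) atTop (𝓝 (∫ y, fa y)) := by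
    refine tendsto_integral_of_dominated_convergence fa (fun n => ?_) hfa_int (fun n => ?_) ?_
    · exact ((contDiff_rpow_norm_sq_add hΩ1 (hεn n) a).continuous).aestronglyMeasurable
    · refine ae_of_all _ fun y => ?_
      have hm := rpow_add_sub_rpow_mem_Icc (sq_nonneg ‖Ω y‖) (hεn n) ha.le ha1
      rw [Real.norm_eq_abs, abs_of_nonneg hm.1]
      exact hm.2
    · exact ae_of_all _ fun y => tendsto_rpow_add_sub_rpow (‖Ω y‖ ^ 2) ha
  have hIle : 3 * γ * ∫ y, fa y ≤ 2 * a * (1 + S) * ∫ y, fa y :=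
    le_of_tendsto (hlim.const_mul (3 * γ)) (Eventually.of_forall hGn_le)
  -- hence `∫ |Ω|^{2a} = 0`
  have hInn : 0 ≤ ∫ y, fa y := integral_nonneg hfa_nn
  have hI0 : ∫ y, fa y = 0 := by
    by_contra hne
    have hIpos : 0 < ∫ y, fa y := lt_of_le_of_ne hInn (Ne.symm hne)
    have : 3 * γ * ∫ y, fa y ≤ 2 * γ * ∫ y, fa y :=
      hIle.trans (mul_le_mul_of_nonneg_right haS hInn)
    nlinarith
  -- so `|Ω|^{2a} ≡ 0` by continuity, and `Ω ≡ 0`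
  have hae : fa =ᵐ[volume] 0 := (integral_eq_zero_iff_of_nonneg hfa_nn hfa_int).1 hI0
  have hfa0 : fa = 0 := (hfa_cont.ae_eq_iff_eq volume continuous_zero).1 hae
  funext y
  have hy : fa y = 0 := congrFun hfa0 y
  have hsq : ‖Ω y‖ ^ 2 = 0 := by
    rcases (Real.rpow_eq_zero (sq_nonneg _) ha.ne').1 hy with h0
    exact h0
  have : Ω y = 0 := by
    rw [← norm_eq_zero]
    exact pow_eq_zero_iff (n := 2) (by norm_num) |>.1 hsq
  simpa [hΩdef] using this

end IsSelfSimilarEulerVorticityProfile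

/-- **Compactly supported vorticity of a velocity-form profile vanishes**: for a stationary
self-similar Euler profile `(U, P)` (CIV (3.3): `U ∈ C²`, `P ∈ C¹`,
`(1−γ)U + ((γ(y−c) + U)·∇)U + ∇P = 0`, `div U = 0`) with `γ > 0`, if `curl U` has compact support
then `curl U = 0` — via (3.3) ⇒ (3.4) (`isSelfSimilarEulerVorticityProfile`). In Chae–Shvydkoy's
variables `γ = 1/(1+α)`, so `γ > 0` is their standing `α > −1`. [cite: ChaeShvydkoy2013, §4 Thm 4.1 (proof, last paragraph)] -/
theorem IsSelfSimilarEulerProfile.curl_eq_zero_of_hasCompactSupport {γ : ℝ} {c : (EuclideanSpace ℝ (Fin 3))}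
    {U : (EuclideanSpace ℝ (Fin 3)) → (EuclideanSpace ℝ (Fin 3))} {P : (EuclideanSpace ℝ (Fin 3)) → ℝ} (h : IsSelfSimilarEulerProfile γ c U P) (hγ : 0 < γ)
    (hc : HasCompactSupport (curl U)) : curl U = 0 :=
  h.isSelfSimilarEulerVorticityProfile.curl_eq_zero_of_hasCompactSupport hγ hc

end Literature.Analysis.FluidPDE

end
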